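import Literature.NumberTheory.ConnesConsani2021.CosineTailEnergy
import Literature.NumberTheory.ConnesConsani2021.ArchimedeanTraceFormulaProofs
import HarnessLib

/-!
# Connes–Consani 2021, Cor. 2.3 and Thm. 4.7 (weak form): hypothesis-free, after Prop. 2.2 (iii)

A. Connes, C. Consani, *Weil positivity and trace formula, the archimedean place*, Selecta Math.
(N.S.) 27 (2021) 77 = arXiv:2006.13771 [bib: `ConnesConsani2021`], §2 Cor. 2.3 (= arXiv Cor. 11) p. 11
and §4 Thm. 4.7 (= arXiv Thm. 27) p. 18.

The named facts `CC2021_cor_2_3_i`, `CC2021_cor_2_3_ii` (`SchwartzKernels.lean`) and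
`CC2021_thm_4_7_weak` (`ArchimedeanTraceFormula.lean`) were typed statements-first and reduced in the
tree to the ONE named fact `CC2021_prop_2_2_iii` (`cor_2_3_i_of_prop_2_2_iii`,
`cor_2_3_ii_of_cor_2_3_i`, `CC2021_thm_4_7_weak_of_prop_2_2_iii`).  Prop. 2.2 (iii) is now the tree
theorem `CC2021_prop_2_2_iii_holds` (`CosineTailEnergy.lean`: the Hilbert–Schmidt energy identity
`4∫_{s ≥ 0}∫‖cosTail g s c‖² = Re L(g ∗ g*)`, assembled from `CosineTailLogMoment` (the `W_∞` half,
through `θ′`) and `CosineTailDeltaSquare` (the `δ` half, through Prop. 2.2 (i))), so the three facts are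
DISCHARGED here, and their printed consequences are restated WITHOUT hypotheses.

Theorems only: no definition, no new named fact.  RH-FREE corpus statements (positivity of an
archimedean trace functional); nothing here bears on the truth of RH.
-/

noncomputable section

open _root_.MeasureTheory Complex Set
open scoped Real InnerProductSpace

namespace Literature.NumberTheory.ConnesConsani2021

open Literature.NumberTheory.LFunctions Literature.Analysis.OperatorTheory

/-- **Cor. 2.3 (i), DISCHARGED**: "the functional `L(f) = ∫ f(ρ⁻¹)(δ(ρ) − τ(ρ))d*ρ` is positive on the
convolution algebra", i.e. `0 ≤ Re L(g ∗ g*)` for every test function `g` — from Prop. 2.2 (iii)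
(`L(g ∗ g*)` is the supremum of the non-negative partial sums of `Tr(ϑ(g ∗ g*)PP̂P)`, the empty sum
being `0`). [cite: ConnesConsani2021, §2 Cor. 2.3 (i) (= arXiv Cor. 11 (i)) p. 11 (chunk p0011:L22–L29)] -/
theorem CC2021_cor_2_3_i_holds : CC2021_cor_2_3_i :=
  cor_2_3_i_of_prop_2_2_iii CC2021_prop_2_2_iii_holds

/-- **Cor. 2.3 (ii), DISCHARGED**: "the function `2θ′(t) + δ̂(t)` is non-negative", `θ′` the derivative
of the Riemann–Siegel angular function and `δ̂(t) = ∫ δ(ρ)ρ^{-it}d*ρ` — from Cor. 2.3 (i) by the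
approximate-identity argument `cor_2_3_ii_of_cor_2_3_i` (eq. (30)).
[cite: ConnesConsani2021, §2 Cor. 2.3 (ii) (= arXiv Cor. 11 (ii)) p. 11 (chunk p0011:L27; proof L30–L41)] -/
theorem CC2021_cor_2_3_ii_holds : CC2021_cor_2_3_ii :=
  cor_2_3_ii_of_cor_2_3_i CC2021_cor_2_3_i_holds

/-- **Thm. 4.7, weak-trace form, DISCHARGED** (the text of route item K1 `SoninTraceFormula`): for every
archimedean density `G`, every test function `g` and every finite orthonormal family `ξ₁, …, ξ_n ⊂ S(1,1)`,
`Σ_i Re⟨ξ_i|ϑ(g ∗ g*)ξ_i⟩ ≤ Re W_∞(g ∗ g*) + Re E_G(g ∗ g*)` — from Prop. 2.2 (iii) and the completeness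
of the even prolate basis (`CC2021_thm_4_7_weak_of_prop_2_2_iii`, seats t3/t4/t10).
[cite: ConnesConsani2021, Thm. 4.7 §4 p. 18 (arXiv Thm. 27, chunk p0018:L33–87); Thm. 6.11 proof §6.7 p. 29] -/
theorem CC2021_thm_4_7_weak_holds : CC2021_thm_4_7_weak :=
  CC2021_thm_4_7_weak_of_prop_2_2_iii CC2021_prop_2_2_iii_holds

variable {g : ℝ → ℂ}

/-- Cor. 2.3 (i) without hypotheses: `0 ≤ Re L(g ∗ g*)`, `L = traceL = W_∞ + D`.
[cite: ConnesConsani2021, §2 Cor. 2.3 (i) p. 11 (chunk p0011:L22–L29)] -/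
theorem re_traceL_weilConv_weilReflect_nonneg (hg : IsWeilTest g) :
    0 ≤ (traceL (weilConv g (weilReflect g))).re :=
  CC2021_cor_2_3_i_holds g hg

/-- The control inequality of §3/§4 p. 15 without hypotheses: `−Re D(g ∗ g*) ≤ Re W_∞(g ∗ g*)` ("in order
to prove Weil's positivity one needs to control the sign of the functional `D`").
[cite: ConnesConsani2021, §4 p. 15 (chunk p0015:L3); §2 Cor. 2.3 (i) p. 11] -/
theorem neg_re_remainderD_le_re_archW (hg : IsWeilTest g) :
    -(remainderD (weilConv g (weilReflect g))).re ≤ (archW (weilConv g (weilReflect g))).re :=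
  neg_remainderD_le_archW CC2021_cor_2_3_i_holds hg

/-- Cor. 2.3 (ii) without hypotheses: `0 ≤ 2θ′(t) + Re δ̂(t)` for every real `t`, with
`θ′ = riemannSiegelThetaDeriv` and `δ̂ = mulFourier (δ ∘ exp)`.
[cite: ConnesConsani2021, §2 Cor. 2.3 (ii) p. 11 (chunk p0011:L27)] -/
theorem two_mul_riemannSiegelThetaDeriv_add_re_mulFourier_traceRemainder_nonneg (t : ℝ) :
    0 ≤ 2 * riemannSiegelThetaDeriv t +
      (mulFourier (fun u : ℝ => (traceRemainder (Real.exp u) : ℂ)) t).re :=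
  CC2021_cor_2_3_ii_holds t

/-- Thm. 4.7 (weak) without hypotheses, in the shape of the (H-TF) binder of `MainInequalityAssembly`
(`hTr_of_thm_4_7_weak`), for ANY archimedean density `G`.
[cite: ConnesConsani2021, Thm. 4.7 §4 p. 18; Thm. 6.11 proof §6.7 p. 29] -/
theorem hTr_of_isArchDensity {G : ℝ → ℂ} (hG : IsArchDensity G) :
    ∀ g : ℝ → ℂ, IsWeilTest g → tsupport g ⊆ Icc (-(Real.log 2 / 2)) (Real.log 2 / 2) →
      ∀ (n : ℕ) (ξ : Fin n → Lp ℂ 2 (volume : Measure ℝ)),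
        Orthonormal ℂ ξ → (∀ i, ξ i ∈ soninSpace 1 1) →
          ∑ i, (soninTraceForm (weilConv g (weilReflect g)) (ξ i : ℝ → ℂ)).re
            ≤ (archW (weilConv g (weilReflect g))).re
              + (evenFunctional G (weilConv g (weilReflect g))).re :=
  hTr_of_thm_4_7_weak CC2021_thm_4_7_weak_holds hG

/-- Thm. 4.7 (weak) without hypotheses at the prolate family's own density `ε ∘ exp`
(`CC2021_thm_4_7_weak.epsDensity`). [cite: ConnesConsani2021, Thm. 4.7 §4 p. 18 (arXiv chunk p0018:L33–40)] -/
theorem sum_re_soninTraceForm_le_archW_add_evenFunctional_epsDensity {ψ : ℕ → ℝ → ℝ}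
    (hψ : ∀ n, IsProlateFunction 1 (2 * n) (ψ n)) (hg : IsWeilTest g)
    {n : ℕ} {ξ : Fin n → Lp ℂ 2 (volume : Measure ℝ)} (hξ : Orthonormal ℂ ξ)
    (hS : ∀ i, ξ i ∈ soninSpace 1 1) :
    ∑ i, (soninTraceForm (weilConv g (weilReflect g)) (ξ i : ℝ → ℂ)).re
      ≤ (archW (weilConv g (weilReflect g))).re
        + (evenFunctional (epsDensity ψ) (weilConv g (weilReflect g))).re :=
  CC2021_thm_4_7_weak_holds.epsDensity hψ hg hξ hS

end Literature.NumberTheory.ConnesConsani2021
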